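/-
Copyright (c) 2026 the pub-hodgecm-mathlib formalisation cell (harness21).  Prover seat hodgecm-mathlib-K2Liu-p01 (g0): Track B «K2-LIT», #184♮ = hLiu418,
socket #13 `sig_K2LiuDoublingUnfold` (U5 «DOUBLING ZETA», LEAD F0P6-plan (g10) DEAL 2026-09-03T21:14:18Z) — THE CLOSER.
-/
import Summits.HodgeConjecture.HodgeConjecture.Theorems.K2LiuDoublingUnfoldOfMainOrbit
import Summits.HodgeConjecture.HodgeConjecture.Theorems.K2LiuDoublingUnfoldMainOrbit
import Literature.NumberTheory.Automorphic.ArchCongruenceTransport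
import HarnessLib

/-!
# Crux `HLiu418`, Track B road `K2_Liu`, unit U5 socket #13 `sig_K2LiuDoublingUnfold`: THE DOUBLING-METHOD UNFOLDING
# `⟨ι^* E(·, f_s), φ₁ ⊗ φ̄₂⟩_{[G×G]} = Z(s, f, φ₁, φ₂^χ)` (Piatetski-Shapiro–Rallis 1987 §1–2 ∕ Liu 2021 (B.5)–(B.6) at `a = 0`)

Cell `hodgecm-mathlib`, crux item hLiu418 = `stmt-HodgeConjecture-24832`; prover K2Liu-p01 (g0).  THEOREMS ONLY (no `def`, no instance, no
notation, no `sorry`); lane `--supports stmt-HodgeConjecture-24832 --as helper`.  This file PAYS socket #13 of the tier-1 socket module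
`Cruxes/HLiu418/Lines/K2_Liu_CurveThetaSigs_U5_DoublingZeta.lean` (ED. 3–6, statement bytes frozen since ED. 3): `doublingUnfold` has the socket's
statement VERBATIM and is ONE `exact` over the two organs landed earlier tonight —
* ★ `K2LiuDoublingUnfoldOfMainOrbit.doublingUnfold_of_mainOrbit` (p855075): the statement with ONE extra hypothesis `hMain` (the single-orbit lemma),
  assembled from the H3 unfolding engine (p854905), the orbit prelims H1∕H2 (p854919), the bridge H5 (p854938), the twist H6 (p854966) and the orbit
  dictionary H7 (p855008);
* ★ `K2LiuDoublingUnfoldMainOrbit.mainOrbit` (H4b) over ★ `K2LiuDoublingUnfoldMainOrbitBlocks` (H4a, p855107): `hMain` holds for `dW 0 ≠ 0` and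
  `diag dV` anisotropic;
plus the transport of the socket's anisotropy hypothesis `_hanis` (on `H`) to `diag dV = c(g)ᵀ (t • H) g` (★ `UnitaryGroup.anisotropic_formCongr_cm`,
`t ≠ 0`).  Of the three ED. 3 guards only `_hdW0 0`, `_ht`, `_hg`, `_hanis` are consumed here (`_hdV0` is consumed inside p855075).
HONEST LABEL.  Count-neutral: `HC_CM` is proved only modulo the 7 printed citations (2 remaining named inputs: hLiu418 = 24832, h413 = 24833) until
rung 0 closes; this file retires socket #13 of the K2_Liu road, not hLiu418.

## References
* [Liu2021] Y. Liu, *Fourier–Jacobi cycles and arithmetic relative trace formula*, Camb. J. Math. 9 (2021): App. B §B.3 (B.5)–(B.6) p. 101, Lem. B.11.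
* [GelbartPiatetskishapiroRallis1987] S. Gelbart, I. Piatetski-Shapiro, S. Rallis, *Explicit constructions of automorphic L-functions*, LNM 1254
  (1987), Part A §1–§2 (the basic identity).
-/

noncomputable section

open scoped Matrix ENNReal ComplexConjugate
open NumberField IsDedekindDomain MeasureTheory

namespace Summit.HodgeConjecture.HodgeConjecture.Cruxes.HLiu418.K2LiuDoublingUnfold

open Literature.NumberTheory.Automorphic Literature.NumberTheory.GaloisRepresentations
open Literature.NumberTheory.GelbartRogawski1991 Literature.NumberTheory.GelbartRogawski1991.GRConstruction
open Literature.NumberTheory.K2Lit.SiegelDoubled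
open Literature.NumberTheory.Automorphic.UnitaryGroup (adelicGroupData adelicVal)
open Literature.AlgebraicGeometry.ShimuraVarieties (hermForm)
open Summit.HodgeConjecture.HodgeConjecture.Cruxes.HLiu418.K2LiuDoublingUnfoldOfMainOrbit (doublingUnfold_of_mainOrbit)
open Summit.HodgeConjecture.HodgeConjecture.Cruxes.HLiu418.K2LiuDoublingUnfoldMainOrbit (mainOrbit)

/-- **Socket #13 `sig_K2LiuDoublingUnfold` — the doubling-method unfolding** (Piatetski-Shapiro–Rallis basic identity for the doubled CM unitary
datum `H = U(hermD)`, `G = U(H)` transported by `ιA` to `U(diag dV)`, `W` a hermitian LINE): for a continuous `P_Δ`-section `f` of weight `χ_s` whose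
Eisenstein series converges absolutely, and continuous automorphic forms `φ₁, φ₂` on `[G]` with the stated product integrability, the doubling
zeta integral `Z(f, φ₁, φ₂^χ)` converges and `⟨ι^*E(f), φ₁ ⊗ φ̄₂⟩_{[G×G]} = Z(f, φ₁, φ₂^χ)` for ONE Haar measure `ν` on `G(𝔸)` (independent of
`χ, s, f, φ₁, φ₂`).  Proof: ★ `doublingUnfold_of_mainOrbit` (the statement modulo the single-orbit lemma `hMain`) + ★ `mainOrbit` (`hMain` from
`dW 0 ≠ 0` and anisotropy of `diag dV`, the latter transported from `_hanis` along `diag dV = c(g)ᵀ (t • H) g`, `t ≠ 0`).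
[cite: Liu2021, §B.3 (B.5)–(B.6) p. 101] [cite: GelbartPiatetskishapiroRallis1987, Part A §1–§2] -/
theorem doublingUnfold :
    ∀ (L : Type) [Field L] [NumberField L] [IsCMField L] {N n : ℕ} (e : Fin N × Fin 1 ≃ Fin n)
      (H : Matrix (Fin N) (Fin N) L)
      (dV : Fin N → L) (hdV : ∀ i, IsCMField.complexConj L (dV i) = dV i)
      (dW : Fin 1 → L) (hdW : ∀ i, IsCMField.complexConj L (dW i) = dW i)
      (_hdV0 : ∀ i, dV i ≠ 0) (_hdW0 : ∀ i, dW i ≠ 0)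
      (t : L) (_ht : t ≠ 0) (g : GL (Fin N) L)
      (_hg : formCongr ((IsCMField.complexConj L : L ≃ₐ[↥(maximalRealSubfield L)] L) : L →+* L) g (t • H) = Matrix.diagonal dV)
      (_hanis : ∀ x : Fin N → L, hermForm (cmConjRingHom L) H x x = 0 → x = 0)
      (μ : Measure (adelicGroupData (↥(maximalRealSubfield L)) L (IsCMField.complexConj L) N H).automorphicQuotient)
      [(adelicGroupData (↥(maximalRealSubfield L)) L (IsCMField.complexConj L) N H).IsAutomorphicMeasure μ]
      (ιA : (adelicGroupData (↥(maximalRealSubfield L)) L (IsCMField.complexConj L) N H).Adelic →*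
        ↥(UnitaryGroup.adelic (↥(maximalRealSubfield L)) L (IsCMField.complexConj L) N (Matrix.diagonal dV))),
      (∀ k, ((ιA k : ↥(UnitaryGroup.adelic (↥(maximalRealSubfield L)) L (IsCMField.complexConj L) N (Matrix.diagonal dV))) :
            GL (Fin N) (AdeleRing (𝓞 L) L)) =
          (toAdeleGL L g)⁻¹ * adelicVal (↥(maximalRealSubfield L)) L (IsCMField.complexConj L) N H k * toAdeleGL L g) →
      ∀ [CompactSpace (adelicGroupData (↥(maximalRealSubfield L)) L (IsCMField.complexConj L) N H).automorphicQuotient]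
        [MeasurableSpace (adelicGroupData (↥(maximalRealSubfield L)) L (IsCMField.complexConj L) N H).Adelic]
        [BorelSpace (adelicGroupData (↥(maximalRealSubfield L)) L (IsCMField.complexConj L) N H).Adelic],
      ∃ ν : Measure (adelicGroupData (↥(maximalRealSubfield L)) L (IsCMField.complexConj L) N H).Adelic, ν.IsHaarMeasure ∧
        ∀ (χ : HeckeCharacter L) (s : ℂ) (f : HA L e dV hdV dW hdW → ℂ),
          IsSiegelDeltaSection L e dV hdV dW hdW χ s f → Continuous f →
          (∀ h : HA L e dV hdV dW hdW, Summable fun q : SiegelDeltaQuot L e dV hdV dW hdW =>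
              ‖f (((Quotient.out q : ratH L e dV hdV dW hdW) : HA L e dV hdV dW hdW) * h)‖) →
          ∀ (φ₁ φ₂ : (adelicGroupData (↥(maximalRealSubfield L)) L (IsCMField.complexConj L) N H).automorphicQuotient → ℂ),
            Continuous φ₁ → Continuous φ₂ →
            Integrable (fun x : (adelicGroupData (↥(maximalRealSubfield L)) L (IsCMField.complexConj L) N H).automorphicQuotient ×
                  (adelicGroupData (↥(maximalRealSubfield L)) L (IsCMField.complexConj L) N H).automorphicQuotient =>
                ‖toQuotFun₂ (adelicGroupData (↥(maximalRealSubfield L)) L (IsCMField.complexConj L) N H)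
                    (eisensteinPullback L e dV hdV dW hdW
                      (adelicGroupData (↥(maximalRealSubfield L)) L (IsCMField.complexConj L) N H) ιA
                      (fun h => ((‖f h‖ : ℝ) : ℂ))) x‖ * ‖φ₁ x.1‖ * ‖φ₂ x.2‖) (μ.prod μ) →
            DoublingZetaConverges L e dV hdV dW hdW (adelicGroupData (↥(maximalRealSubfield L)) L (IsCMField.complexConj L) N H)
                ν μ ιA f φ₁
                (fun x => starRingEnd ℂ (siegelDeltaCharacter L e dV hdV dW hdW χ s
                    (iotaV L e dV hdV dW hdW
                      (ιA ((Quotient.out (x : (adelicGroupData (↥(maximalRealSubfield L)) L (IsCMField.complexConj L) N H).Adelic ⧸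
                          (adelicGroupData (↥(maximalRealSubfield L)) L (IsCMField.complexConj L) N H).quotientSubgroup)) :
                          (adelicGroupData (↥(maximalRealSubfield L)) L (IsCMField.complexConj L) N H).Adelic)⁻¹,
                       ιA ((Quotient.out (x : (adelicGroupData (↥(maximalRealSubfield L)) L (IsCMField.complexConj L) N H).Adelic ⧸
                          (adelicGroupData (↥(maximalRealSubfield L)) L (IsCMField.complexConj L) N H).quotientSubgroup)) :
                          (adelicGroupData (↥(maximalRealSubfield L)) L (IsCMField.complexConj L) N H).Adelic)⁻¹))) * φ₂ x) ∧
              doublingPairing (adelicGroupData (↥(maximalRealSubfield L)) L (IsCMField.complexConj L) N H) μ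
                  (toQuotFun₂ (adelicGroupData (↥(maximalRealSubfield L)) L (IsCMField.complexConj L) N H)
                    (eisensteinPullback L e dV hdV dW hdW
                      (adelicGroupData (↥(maximalRealSubfield L)) L (IsCMField.complexConj L) N H) ιA f)) φ₁ φ₂ =
                doublingZeta L e dV hdV dW hdW (adelicGroupData (↥(maximalRealSubfield L)) L (IsCMField.complexConj L) N H)
                  ν μ ιA f φ₁
                  (fun x => starRingEnd ℂ (siegelDeltaCharacter L e dV hdV dW hdW χ s
                      (iotaV L e dV hdV dW hdW
                        (ιA ((Quotient.out (x : (adelicGroupData (↥(maximalRealSubfield L)) L (IsCMField.complexConj L) N H).Adelic ⧸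
                            (adelicGroupData (↥(maximalRealSubfield L)) L (IsCMField.complexConj L) N H).quotientSubgroup)) :
                            (adelicGroupData (↥(maximalRealSubfield L)) L (IsCMField.complexConj L) N H).Adelic)⁻¹,
                         ιA ((Quotient.out (x : (adelicGroupData (↥(maximalRealSubfield L)) L (IsCMField.complexConj L) N H).Adelic ⧸
                            (adelicGroupData (↥(maximalRealSubfield L)) L (IsCMField.complexConj L) N H).quotientSubgroup)) :
                            (adelicGroupData (↥(maximalRealSubfield L)) L (IsCMField.complexConj L) N H).Adelic)⁻¹))) * φ₂ x) := by
  intro L _ _ _ N n e H dV hdV dW hdW hdV0 hdW0 t ht g hg hanis μ _ ιA hιA _ _ _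
  -- anisotropy of `t • H` (from that of `H`, `t ≠ 0`), then of `diag dV = c(g)ᵀ (t • H) g` (★ `anisotropic_formCongr_cm`)
  have htH : ∀ x : Fin N → L, hermForm (cmConjRingHom L) (t • H) x x = 0 → x = 0 := by
    intro x hx
    have h1 : hermForm (cmConjRingHom L) (t • H) x x = t * hermForm (cmConjRingHom L) H x x := by
      simp only [hermForm, Matrix.smul_mulVec, dotProduct_smul, smul_eq_mul]
    rw [h1] at hx
    exact hanis x ((mul_eq_zero.1 hx).resolve_left ht)
  have hanisV : ∀ x : Fin N → L, hermForm (cmConjRingHom L) (Matrix.diagonal dV) x x = 0 → x = 0 := by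
    intro x hx
    rw [← hg] at hx
    exact UnitaryGroup.anisotropic_formCongr_cm L g htH x hx
  exact doublingUnfold_of_mainOrbit L e H dV hdV dW hdW hdV0 hdW0 t ht g hg hanis
    (fun h => mainOrbit L e dV hdV dW hdW (hdW0 0) hanisV h) μ ιA hιA

end Summit.HodgeConjecture.HodgeConjecture.Cruxes.HLiu418.K2LiuDoublingUnfold
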